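import Literature.Analysis.FluidPDE.CompressibleEulerImplosionSonicSeries
import Literature.Analysis.FluidPDE.CompressibleEulerImplosionOriginSeriesTM
import Literature.Analysis.ValidatedNumerics.TaylorModelExpr
import HarnessLib

/-!
# Buckmaster–Cao-Labora–Gómez-Serrano at `γ = 5/3`: parameter-uniform Taylor models of the sonic series

Companion of `CompressibleEulerImplosionSonicSeries` (Props. 2.2–2.3 of the paper: the ordinary Taylor
coefficients `wₙ(r)`, `zₙ(r)` of the analytic branch `(W^{(r)}, Z^{(r)})` through the sonic point `P_s`,
forced by the recursions (2.9) `w_{n+2} = nextW …` and (2.10) `z_{n+2} = nextZ …`). The computer-assisted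
uses of the branch (App. B of the paper; here: clause (e) of the cavity tube of the pinned profile and the
start values of the near-sonic barriers) need the first coefficients UNIFORMLY for `r` in a window
`r = r(ρ)`, `|ρ| ≤ h`. This file is the reusable ENGINE, the sonic analogue of
`CompressibleEulerImplosionOriginSeriesTM`: computable mirrors `nextWTM`, `nextZTM` of the two recursions in
the Taylor-model arithmetic of `Literature.Analysis.ValidatedNumerics.TaylorModel` (models in `ρ`, degree
`D`, scale `S`) with soundness theorems `tmem_nextWTM`, `tmem_nextZTM`: if the input models enclose
`ρ ↦ wᵢ(r(ρ))`, `ρ ↦ zᵢ(r(ρ))` for the needed indices then the output model encloses the next coefficient.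
The divisions by `D_W(P_s)(n+1)` and by `slopeZ(m) = D_{Z,1}(m − k(r))` are `ρ`-dependent; they go through
the verified inverse `tmem_inv_of_check` of the Taylor-model library with a COMPUTABLE candidate (power-series
inversion of the midpoint polynomial, `invCand`) and a computable error (`invErr`), packaged as `tinvC` with
soundness `tmem_tinvC` under the decidable check `invOK`. The generator `szModels` iterates the two mirrors;
its literal output is certified stepwise by `CompressibleEulerImplosionSonicSeriesTMCheck`. No facts, no axioms.

[cite: BuckmasterCaolaboraGomezserrano2025, Prop. 2.2, Prop. 2.3, eqs. (2.9)–(2.10), App. B]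
-/

namespace Literature.Analysis.FluidPDE

namespace BuckmasterCaolaboraGomezserrano2025

namespace Monatomic

namespace SonicSeries

open Finset
open Literature.Analysis.ValidatedNumerics Literature.Analysis.ValidatedNumerics.PolyMP
open Literature.Analysis.ValidatedNumerics.NumericsMP
open OriginSeries (tsumI tmem_tsumI ent)

/-! ### A computable verified inverse -/

/-- Midpoint of a scaled interval, as a rational. [folklore] -/
def midQ (S : ℕ) (I : MI) : ℚ := ((I.lo + I.hi : ℤ) : ℚ) / (2 * (S : ℚ))

/-- Power-series inversion of the midpoint polynomial `g₀ + g₁ρ + …` to degree `n`: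
`q₀ = 1/g₀`, `q_k = −(Σ_{1≤i≤k} gᵢ q_{k−i})/g₀`. [folklore] -/
def invCandQ (g : List ℚ) : ℕ → List ℚ
  | 0 => [(g.getD 0 0)⁻¹]
  | k + 1 =>
      let qs := invCandQ g k
      qs ++ [-((g.getD 0 0)⁻¹) *
        (((List.range (k + 1)).map fun i => g.getD (i + 1) 0 * qs.getD (k - i) 0).sum)]

/-- The thin candidate inverse model (scaled integer coefficients of `invCandQ`). [folklore] -/
def invCand (S : ℕ) (D : ℕ) (G : IPoly) : List ℤ :=
  (invCandQ (G.map (midQ S)) D).map fun x => Rat.floor (x * (S : ℚ))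

/-- The scaled error radius making `checkInv` pass whenever the enclosed function is bounded away from
zero: `e = ⌈B·S/m⌉ + 1` with `m` the scaled distance of `G` from `0` and `B` the scaled bound of the residual
`1 − G·Q`. [folklore] -/
def invErr (S : ℕ) (h : ℚ) (D : ℕ) (G Q : IPoly) : ℕ :=
  let m : ℤ := max (tlowerI S h G) (-tupperI S h G)
  let B : ℤ := tabsI S h (tsubI [MI.ofInt S 1] (tmulI S h D G Q))
  (Numerics.cdiv (B * S) m + 1).toNat

/-- The decidable validation of the computable inverse. [folklore] -/
def invOK (S : ℕ) (h : ℚ) (D : ℕ) (G : IPoly) : Bool :=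
  checkInv S h D G (thinI (invCand S D G)) (invErr S h D G (thinI (invCand S D G)))

/-- **The computable verified inverse** of a Taylor model. [folklore] -/
def tinvC (S : ℕ) (h : ℚ) (D : ℕ) (G : IPoly) : IPoly :=
  widen0 (thinI (invCand S D G)) (invErr S h D G (thinI (invCand S D G)))

/-- Soundness of `tinvC`: if `invOK` accepts, `tinvC G` encloses `1/g`. [folklore] -/
theorem tmem_tinvC {S : ℕ} (hS : 0 < S) {h : ℚ} (h0 : 0 ≤ h) {D : ℕ} {g : ℝ → ℝ} {G : IPoly}
    (hg : TMem S h g G) (hok : invOK S h D G = true) : TMem S h (fun ρ => (g ρ)⁻¹) (tinvC S h D G) :=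
  tmem_inv_of_check hS h0 hg (tmem_thin hS h (invCand S D G)) hok

/-! ### A computable verified square root -/

/-- Heron iteration on naturals (a numerically adequate integer square root; only used to build a
candidate, soundness comes from `checkSqrt`). [folklore] -/
def heron (n : ℕ) : ℕ → ℕ → ℕ
  | 0, x => x
  | k + 1, x => if x = 0 then 0 else heron n k ((x + n / x) / 2)

/-- Integer square root candidate of a natural number (bit-length initial guess + Heron steps). [folklore] -/
def isqrt (n : ℕ) : ℕ := heron n 200 (2 ^ ((Nat.log2 n) / 2 + 1))

/-- Power-series square root of the midpoint polynomial to degree `n`, given `q₀ ≈ √g₀`: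
`q_k = (g_k − Σ_{1≤i<k} qᵢ q_{k−i})/(2q₀)`. [folklore] -/
def sqrtCandQ (g : List ℚ) (q0 : ℚ) : ℕ → List ℚ
  | 0 => [q0]
  | k + 1 =>
      let qs := sqrtCandQ g q0 k
      qs ++ [(g.getD (k + 1) 0 -
        ((List.range k).map fun i => qs.getD (i + 1) 0 * qs.getD (k - i) 0).sum) / (2 * q0)]

/-- The thin candidate square-root model (scaled integer coefficients). [folklore] -/
def sqrtCand (S : ℕ) (D : ℕ) (G : IPoly) : List ℤ :=
  let g := G.map (midQ S)
  let g0 : ℚ := g.getD 0 0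
  let q0 : ℚ := ((isqrt (Rat.floor (g0 * (S : ℚ) * (S : ℚ))).toNat : ℕ) : ℚ) / (S : ℚ)
  (sqrtCandQ g q0 D).map fun x => Rat.floor (x * (S : ℚ))

/-- The scaled error radius for `checkSqrt`: `e = ⌈B·S/s⌉ + 1`, `s` the scaled lower bound of the candidate,
`B` the scaled bound of the residual `G − Q²`. [folklore] -/
def sqrtErr (S : ℕ) (h : ℚ) (D : ℕ) (G Q : IPoly) : ℕ :=
  let s : ℤ := tlowerI S h Q
  let B : ℤ := tabsI S h (tsubI G (tmulI S h D Q Q))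
  (Numerics.cdiv (B * S) s + 1).toNat

/-- The decidable validation of the computable square root. [folklore] -/
def sqrtOK (S : ℕ) (h : ℚ) (D : ℕ) (G : IPoly) : Bool :=
  checkSqrt S h D G (thinI (sqrtCand S D G)) (sqrtErr S h D G (thinI (sqrtCand S D G)))

/-- **The computable verified square root** of a Taylor model. [folklore] -/
def tsqrtC (S : ℕ) (h : ℚ) (D : ℕ) (G : IPoly) : IPoly :=
  widen0 (thinI (sqrtCand S D G)) (sqrtErr S h D G (thinI (sqrtCand S D G)))

/-- Soundness of `tsqrtC`: if `sqrtOK` accepts, `tsqrtC G` encloses `√g`. [folklore] -/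
theorem tmem_tsqrtC {S : ℕ} (hS : 0 < S) {h : ℚ} (h0 : 0 ≤ h) {D : ℕ} {g : ℝ → ℝ} {G : IPoly}
    (hg : TMem S h g G) (hok : sqrtOK S h D G = true) :
    TMem S h (fun ρ => Real.sqrt (g ρ)) (tsqrtC S h D G) :=
  tmem_sqrt_of_check hS h0 hg (tmem_thin hS h (sqrtCand S D G)) hok

/-! ### The window data: models of `r`, `q(r) = √(r² − 6r + 6)`, `p(r) = √(2(r − 1))` -/

/-- Model of `r = r_m + ρ`. [folklore] -/
def rTM (S : ℕ) (rm : ℚ) : IPoly := tvar S (ofRat S rm)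

/-- Model of `disc r = r² − 6r + 6`. [cite: BuckmasterCaolaboraGomezserrano2025, §2.1] -/
def discTM (S : ℕ) (h : ℚ) (D : ℕ) (R : IPoly) : IPoly :=
  taddI (tsubI (tmulI S h D R R) (tsmulInt 6 R)) (tconst (MI.ofInt S 6))

/-- Model of `2(r − 1)`. [cite: BuckmasterCaolaboraGomezserrano2025, §2.1] -/
def ppTM (S : ℕ) (R : IPoly) : IPoly := tsmulInt 2 (tsubI R (tconst (MI.ofInt S 1)))

/-- Model of `q(r)` (verified square root of `discTM`). [cite: BuckmasterCaolaboraGomezserrano2025, §2.1] -/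
def qTM (S : ℕ) (h : ℚ) (D : ℕ) (R : IPoly) : IPoly := tsqrtC S h D (discTM S h D R)

/-- Model of `p(r)` (verified square root of `ppTM`). [cite: BuckmasterCaolaboraGomezserrano2025, §2.1] -/
def pTM (S : ℕ) (h : ℚ) (D : ℕ) (R : IPoly) : IPoly := tsqrtC S h D (ppTM S R)

/-- [folklore] -/
theorem tmem_rTM (S : ℕ) (h : ℚ) (rm : ℚ) : TMem S h (fun ρ => (rm : ℝ) + ρ) (rTM S rm) := by
  have := tmem_var (S := S) (h := h) (mem_ofRat S rm)
  exact this

/-- [cite: BuckmasterCaolaboraGomezserrano2025, §2.1] -/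
theorem tmem_discTM {S : ℕ} (hS : 0 < S) {h : ℚ} (h0 : 0 ≤ h) (D : ℕ) {rF : ℝ → ℝ} {R : IPoly}
    (hR : TMem S h rF R) : TMem S h (fun ρ => disc (rF ρ)) (discTM S h D R) := by
  have h6 : TMem S h (fun _ => (6 : ℝ)) (tconst (MI.ofInt S 6)) := by
    simpa using tmem_const (S := S) (h := h) (MI.mem_ofInt S 6)
  have := tmem_add (tmem_sub (tmem_mul hS h0 D hR hR) (tmem_smulInt 6 hR)) h6
  refine (show (fun ρ => disc (rF ρ)) = _ from ?_) ▸ this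
  funext ρ; unfold disc; push_cast; ring

/-- [cite: BuckmasterCaolaboraGomezserrano2025, §2.1] -/
theorem tmem_ppTM {S : ℕ} {h : ℚ} {rF : ℝ → ℝ} {R : IPoly} (hR : TMem S h rF R) :
    TMem S h (fun ρ => 2 * (rF ρ - 1)) (ppTM S R) := by
  have h1 : TMem S h (fun _ => (1 : ℝ)) (tconst (MI.ofInt S 1)) := by
    simpa using tmem_const (S := S) (h := h) (MI.mem_ofInt S 1)
  have := tmem_smulInt 2 (tmem_sub hR h1)
  refine (show (fun ρ => 2 * (rF ρ - 1)) = _ from ?_) ▸ this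
  funext ρ; push_cast; ring

/-- Soundness of `qTM` under its check. [cite: BuckmasterCaolaboraGomezserrano2025, §2.1] -/
theorem tmem_qTM {S : ℕ} (hS : 0 < S) {h : ℚ} (h0 : 0 ≤ h) {D : ℕ} {rF : ℝ → ℝ} {R : IPoly}
    (hR : TMem S h rF R) (hok : sqrtOK S h D (discTM S h D R) = true) :
    TMem S h (fun ρ => q (rF ρ)) (qTM S h D R) :=
  tmem_tsqrtC hS h0 (tmem_discTM hS h0 D hR) hok

/-- Soundness of `pTM` under its check. [cite: BuckmasterCaolaboraGomezserrano2025, §2.1] -/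
theorem tmem_pTM {S : ℕ} (hS : 0 < S) {h : ℚ} (h0 : 0 ≤ h) {D : ℕ} {rF : ℝ → ℝ} {R : IPoly}
    (hR : TMem S h rF R) (hok : sqrtOK S h D (ppTM S R) = true) :
    TMem S h (fun ρ => p (rF ρ)) (pTM S h D R) :=
  tmem_tsqrtC hS h0 (tmem_ppTM hR) hok

/-! ### Mirrors of the coefficient operations -/

/-- Model of the Cauchy coefficient `Σ_{k≤n} F_k G_{n−k}`. [folklore] -/
def cauchyTM (S : ℕ) (h : ℚ) (D : ℕ) (L M : List IPoly) (n : ℕ) : IPoly :=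
  tsumI S (fun k => tmulI S h D (ent S L k) (ent S M (n - k))) (n + 1)

/-- Model of the shifted Cauchy sum `Σ_{k≤n} F_{k+1} G_{n+1−k}` of `restZ`. [folklore] -/
def shcauchyTM (S : ℕ) (h : ℚ) (D : ℕ) (L M : List IPoly) (n : ℕ) : IPoly :=
  tsumI S (fun k => tmulI S h D (ent S L (k + 1)) (ent S M (n + 1 - k))) (n + 1)

/-- Model of `D_{W,j} = (2wⱼ + zⱼ)/3`, `j ≥ 1`. [cite: BuckmasterCaolaboraGomezserrano2025, eq. (2.10)] -/
def dWcTM (S : ℕ) (L M : List IPoly) (j : ℕ) : IPoly :=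
  tdivNat 3 (taddI (tsmulInt 2 (ent S L j)) (ent S M j))

/-- Model of `D_{Z,j} = (wⱼ + 2zⱼ)/3`, `j ≥ 1`. [cite: BuckmasterCaolaboraGomezserrano2025, eq. (2.10)] -/
def dZcTM (S : ℕ) (L M : List IPoly) (j : ℕ) : IPoly :=
  tdivNat 3 (taddI (ent S L j) (tsmulInt 2 (ent S M j)))

/-- Model of `D_{W,0} = 1 + (2w₀ + z₀)/3 = D_W(P_s)`. [cite: BuckmasterCaolaboraGomezserrano2025, eq. (2.10)] -/
def dWc0TM (S : ℕ) (L M : List IPoly) : IPoly :=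
  taddI (tconst (MI.ofInt S 1)) (dWcTM S L M 0)

/-- Model of `N_{W,n}` (eq. (2.11)). [cite: BuckmasterCaolaboraGomezserrano2025, eq. (2.11)] -/
def nWcTM (S : ℕ) (h : ℚ) (D : ℕ) (R : IPoly) (L M : List IPoly) (n : ℕ) : IPoly :=
  taddI (taddI (taddI (tnegI (tmulI S h D R (ent S L n)))
    (tdivNat 6 (tsmulInt (-5) (cauchyTM S h D L L n))))
    (tdivNat 3 (tsmulInt (-1) (cauchyTM S h D L M n))))
    (tdivNat 6 (cauchyTM S h D M M n))

/-- Model of `restW r w z n`. [cite: BuckmasterCaolaboraGomezserrano2025, eq. (2.9)] -/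
def restWTM (S : ℕ) (h : ℚ) (D : ℕ) (R : IPoly) (L M : List IPoly) (n : ℕ) : IPoly :=
  tsubI (tsumI S (fun k => tmulI S h D (dWcTM S L M (k + 1))
      (tsmulInt (((n - (k + 1) : ℕ) : ℤ) + 1) (ent S L (n - (k + 1) + 1)))) n)
    (nWcTM S h D R L M n)

/-- **Mirror of (2.9)**: model of `w_{n+1} = −restW(n)/(D_{W,0}(n+1))`, given the model `IW` of `1/D_{W,0}`.
[cite: BuckmasterCaolaboraGomezserrano2025, eq. (2.9)] -/
def nextWTM (S : ℕ) (h : ℚ) (D : ℕ) (R IW : IPoly) (L M : List IPoly) (n : ℕ) : IPoly :=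
  tnegI (tdivNat (n + 1) (tmulI S h D IW (restWTM S h D R L M n)))

/-- Model of `coefW w z = z₁/3 − (w₀ − z₀)/3`. [cite: BuckmasterCaolaboraGomezserrano2025, eq. (2.10)] -/
def coefWTM (S : ℕ) (L M : List IPoly) : IPoly :=
  tsubI (tdivNat 3 (ent S M 1)) (tdivNat 3 (tsubI (ent S L 0) (ent S M 0)))

/-- Model of `slopeZ r w z m = D_{Z,1} m + (2/3) z₁ + (r + w₀/3 + 5z₀/3)`.
[cite: BuckmasterCaolaboraGomezserrano2025, eq. (2.10)] -/
def slopeZTM (S : ℕ) (R : IPoly) (L M : List IPoly) (m : ℕ) : IPoly :=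
  taddI (taddI (tsmulInt (m : ℤ) (dZcTM S L M 1)) (tdivNat 3 (tsmulInt 2 (ent S M 1))))
    (taddI R (tdivNat 3 (taddI (ent S L 0) (tsmulInt 5 (ent S M 0)))))

/-- Model of `restZ w z n`. [cite: BuckmasterCaolaboraGomezserrano2025, eq. (2.10)] -/
def restZTM (S : ℕ) (h : ℚ) (D : ℕ) (L M : List IPoly) (n : ℕ) : IPoly :=
  tsubI (taddI (taddI
    (tsumI S (fun k => tmulI S h D (dZcTM S L M (k + 2))
      (tsmulInt (((n - k : ℕ) : ℤ) + 1) (ent S M (n - k + 1)))) n)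
    (tdivNat 3 (shcauchyTM S h D L M n)))
    (tdivNat 6 (tsmulInt 5 (shcauchyTM S h D M M n))))
    (tdivNat 6 (shcauchyTM S h D L L n))

/-- **Mirror of (2.10)**: model of `z_{n+2} = −(coefW·w_{n+2} + restZ(n))/slopeZ(n+2)`, reading `w_{n+2}` from
entry `n + 2` of `L`, given the model `IZ` of `1/slopeZ(n+2)`. [cite: BuckmasterCaolaboraGomezserrano2025, eq. (2.10)] -/
def nextZTM (S : ℕ) (h : ℚ) (D : ℕ) (L M : List IPoly) (n : ℕ) (IZ : IPoly) : IPoly :=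
  tnegI (tmulI S h D IZ (taddI (tmulI S h D (coefWTM S L M) (ent S L (n + 2))) (restZTM S h D L M n)))

/-! ### The data at `P_s` and the generator -/

/-- Model of `W₀ = 3 − 2r + 2q`. [cite: BuckmasterCaolaboraGomezserrano2025, §2.1] -/
def W0TM (S : ℕ) (R Q : IPoly) : IPoly :=
  taddI (tsubI (tconst (MI.ofInt S 3)) (tsmulInt 2 R)) (tsmulInt 2 Q)

/-- Model of `Z₀ = r − 3 − q`. [cite: BuckmasterCaolaboraGomezserrano2025, §2.1] -/
def Z0TM (S : ℕ) (R Q : IPoly) : IPoly := tsubI (tsubI R (tconst (MI.ofInt S 3))) Q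

/-- Model of `W₁ = −3q`. [cite: BuckmasterCaolaboraGomezserrano2025, eq. (2.2)] -/
def W1TM (Q : IPoly) : IPoly := tsmulInt (-3) Q

/-- Model of `Z₁ = (3/2)(2 − r + q − p)`. [cite: BuckmasterCaolaboraGomezserrano2025, eq. (2.6)] -/
def Z1TM (S : ℕ) (R Q P : IPoly) : IPoly :=
  tdivNat 2 (tsmulInt 3 (tsubI (taddI (tsubI (tconst (MI.ofInt S 2)) R) Q) P))

/-- **The generator**: the pair of lists of models of `(w₀, …, w_{n+1})`, `(z₀, …, z_{n+1})` obtained by iterating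
the two mirrors from the data models `R ∋ r`, `Q ∋ q(r)`, `P ∋ p(r)` (computable; its literal output is what the
stepwise certificates of `CompressibleEulerImplosionSonicSeriesTMCheck` re-verify in the kernel).
[cite: BuckmasterCaolaboraGomezserrano2025, Prop. 2.2, App. B] -/
def szModels (S : ℕ) (h : ℚ) (D : ℕ) (R Q P : IPoly) : ℕ → List IPoly × List IPoly
  | 0 => ([W0TM S R Q, W1TM Q], [Z0TM S R Q, Z1TM S R Q P])
  | n + 1 =>
      let LM := szModels S h D R Q P n
      let IW := tinvC S h D (dWc0TM S LM.1 LM.2)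
      let L' := LM.1 ++ [nextWTM S h D R IW LM.1 LM.2 (n + 1)]
      let IZ := tinvC S h D (slopeZTM S R L' LM.2 (n + 2))
      (L', LM.2 ++ [nextZTM S h D L' LM.2 n IZ])

/-! ### Soundness of the mirrors -/

variable {S : ℕ} {h : ℚ} {D : ℕ} {rF : ℝ → ℝ}

/-- Soundness of `cauchyTM`. [folklore] -/
theorem tmem_cauchyTM (hS : 0 < S) (h0 : 0 ≤ h) {F G : ℝ → ℕ → ℝ} {L M : List IPoly} {n : ℕ}
    (hL : ∀ i, i ≤ n → TMem S h (fun ρ => F ρ i) (ent S L i))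
    (hM : ∀ i, i ≤ n → TMem S h (fun ρ => G ρ i) (ent S M i)) :
    TMem S h (fun ρ => cauchy (F ρ) (G ρ) n) (cauchyTM S h D L M n) := by
  unfold cauchy cauchyTM
  exact tmem_tsumI (n + 1) fun k hk =>
    tmem_mul hS h0 D (hL k (by omega)) (hM (n - k) (by omega))

/-- Soundness of `shcauchyTM`. [folklore] -/
theorem tmem_shcauchyTM (hS : 0 < S) (h0 : 0 ≤ h) {F G : ℝ → ℕ → ℝ} {L M : List IPoly} {n : ℕ}
    (hL : ∀ i, i ≤ n + 1 → TMem S h (fun ρ => F ρ i) (ent S L i))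
    (hM : ∀ i, i ≤ n + 1 → TMem S h (fun ρ => G ρ i) (ent S M i)) :
    TMem S h (fun ρ => ∑ k ∈ range (n + 1), F ρ (k + 1) * G ρ (n + 1 - k)) (shcauchyTM S h D L M n) := by
  unfold shcauchyTM
  exact tmem_tsumI (n + 1) fun k hk =>
    tmem_mul hS h0 D (hL (k + 1) (by omega)) (hM (n + 1 - k) (by omega))

/-- Soundness of `dWcTM` at `j ≥ 1`. [cite: BuckmasterCaolaboraGomezserrano2025, eq. (2.10)] -/
theorem tmem_dWcTM {F G : ℝ → ℕ → ℝ} {L M : List IPoly} {j : ℕ}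
    (hL : TMem S h (fun ρ => F ρ (j + 1)) (ent S L (j + 1)))
    (hM : TMem S h (fun ρ => G ρ (j + 1)) (ent S M (j + 1))) :
    TMem S h (fun ρ => dWc (F ρ) (G ρ) (j + 1)) (dWcTM S L M (j + 1)) := by
  have := tmem_divNat (n := 3) (by norm_num) (tmem_add (tmem_smulInt 2 hL) hM)
  refine (show (fun ρ => dWc (F ρ) (G ρ) (j + 1)) = _ from ?_) ▸ this
  funext ρ; rw [dWc_succ]; push_cast; ring

/-- Soundness of `dZcTM` at `j ≥ 1`. [cite: BuckmasterCaolaboraGomezserrano2025, eq. (2.10)] -/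
theorem tmem_dZcTM {F G : ℝ → ℕ → ℝ} {L M : List IPoly} {j : ℕ}
    (hL : TMem S h (fun ρ => F ρ (j + 1)) (ent S L (j + 1)))
    (hM : TMem S h (fun ρ => G ρ (j + 1)) (ent S M (j + 1))) :
    TMem S h (fun ρ => dZc (F ρ) (G ρ) (j + 1)) (dZcTM S L M (j + 1)) := by
  have := tmem_divNat (n := 3) (by norm_num) (tmem_add hL (tmem_smulInt 2 hM))
  refine (show (fun ρ => dZc (F ρ) (G ρ) (j + 1)) = _ from ?_) ▸ this
  funext ρ; rw [dZc_succ]; push_cast; ring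

/-- Soundness of `dWc0TM`. [cite: BuckmasterCaolaboraGomezserrano2025, eq. (2.10)] -/
theorem tmem_dWc0TM {F G : ℝ → ℕ → ℝ} {L M : List IPoly}
    (hL : TMem S h (fun ρ => F ρ 0) (ent S L 0)) (hM : TMem S h (fun ρ => G ρ 0) (ent S M 0)) :
    TMem S h (fun ρ => dWc (F ρ) (G ρ) 0) (dWc0TM S L M) := by
  have h1 : TMem S h (fun _ => (1 : ℝ)) (tconst (MI.ofInt S 1)) := by
    simpa using tmem_const (S := S) (h := h) (MI.mem_ofInt S 1)
  have := tmem_add h1 (tmem_divNat (n := 3) (by norm_num) (tmem_add (tmem_smulInt 2 hL) hM))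
  refine (show (fun ρ => dWc (F ρ) (G ρ) 0) = _ from ?_) ▸ this
  funext ρ; simp only [dWc, if_true]; push_cast; ring

/-- Soundness of `nWcTM`. [cite: BuckmasterCaolaboraGomezserrano2025, eq. (2.11)] -/
theorem tmem_nWcTM (hS : 0 < S) (h0 : 0 ≤ h) {R : IPoly} (hR : TMem S h rF R)
    {F G : ℝ → ℕ → ℝ} {L M : List IPoly} {n : ℕ}
    (hL : ∀ i, i ≤ n → TMem S h (fun ρ => F ρ i) (ent S L i))
    (hM : ∀ i, i ≤ n → TMem S h (fun ρ => G ρ i) (ent S M i)) :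
    TMem S h (fun ρ => nWc (rF ρ) (F ρ) (G ρ) n) (nWcTM S h D R L M n) := by
  have hA := tmem_neg (tmem_mul hS h0 D hR (hL n le_rfl))
  have hB := tmem_divNat (n := 6) (by norm_num) (tmem_smulInt (-5) (tmem_cauchyTM (D := D) hS h0 hL hL))
  have hC := tmem_divNat (n := 3) (by norm_num) (tmem_smulInt (-1) (tmem_cauchyTM (D := D) hS h0 hL hM))
  have hE := tmem_divNat (n := 6) (by norm_num) (tmem_cauchyTM (D := D) hS h0 hM hM)
  have := tmem_add (tmem_add (tmem_add hA hB) hC) hE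
  refine (show (fun ρ => nWc (rF ρ) (F ρ) (G ρ) n) = _ from ?_) ▸ this
  funext ρ; unfold nWc; push_cast; ring

/-- Soundness of `restWTM`. [cite: BuckmasterCaolaboraGomezserrano2025, eq. (2.9)] -/
theorem tmem_restWTM (hS : 0 < S) (h0 : 0 ≤ h) {R : IPoly} (hR : TMem S h rF R)
    {F G : ℝ → ℕ → ℝ} {L M : List IPoly} {n : ℕ}
    (hL : ∀ i, i ≤ n → TMem S h (fun ρ => F ρ i) (ent S L i))
    (hM : ∀ i, i ≤ n → TMem S h (fun ρ => G ρ i) (ent S M i)) :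
    TMem S h (fun ρ => restW (rF ρ) (F ρ) (G ρ) n) (restWTM S h D R L M n) := by
  have hsum : TMem S h (fun ρ => ∑ k ∈ range n, dWc (F ρ) (G ρ) (k + 1) * (((n - (k + 1) : ℕ) : ℝ) + 1)
      * F ρ (n - (k + 1) + 1)) (tsumI S (fun k => tmulI S h D (dWcTM S L M (k + 1))
      (tsmulInt (((n - (k + 1) : ℕ) : ℤ) + 1) (ent S L (n - (k + 1) + 1)))) n) := by
    refine tmem_tsumI n fun k hk => ?_
    have h1 := tmem_dWcTM (S := S) (h := h) (hL (k + 1) hk) (hM (k + 1) hk)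
    have h2 := tmem_smulInt (((n - (k + 1) : ℕ) : ℤ) + 1) (hL (n - (k + 1) + 1) (by omega))
    have := tmem_mul hS h0 D h1 h2
    refine (show (fun ρ => dWc (F ρ) (G ρ) (k + 1) * (((n - (k + 1) : ℕ) : ℝ) + 1) * F ρ (n - (k + 1) + 1)) = _
      from ?_) ▸ this
    funext ρ; push_cast; ring
  have := tmem_sub hsum (tmem_nWcTM (D := D) hS h0 hR hL hM)
  refine (show (fun ρ => restW (rF ρ) (F ρ) (G ρ) n) = _ from ?_) ▸ this
  funext ρ; unfold restW; rfl

/-- **Soundness of the mirror of (2.9).** If `IW ∋ 1/D_{W,0}` and the entries `≤ n` (`n ≥ 1`) enclose the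
coefficients, then `nextWTM … n ∋ w_{n+1}`. [cite: BuckmasterCaolaboraGomezserrano2025, eq. (2.9)] -/
theorem tmem_nextWTM (hS : 0 < S) (h0 : 0 ≤ h) {R IW : IPoly} (hR : TMem S h rF R)
    (hIW : TMem S h (fun ρ => (dWc (w (rF ρ)) (z (rF ρ)) 0)⁻¹) IW)
    {L M : List IPoly} {n : ℕ}
    (hL : ∀ i, i ≤ n + 1 → TMem S h (fun ρ => w (rF ρ) i) (ent S L i))
    (hM : ∀ i, i ≤ n + 1 → TMem S h (fun ρ => z (rF ρ) i) (ent S M i)) :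
    TMem S h (fun ρ => w (rF ρ) (n + 2)) (nextWTM S h D R IW L M (n + 1)) := by
  have hr := tmem_restWTM (D := D) (F := fun ρ i => w (rF ρ) i) (G := fun ρ i => z (rF ρ) i) hS h0 hR hL hM
  have := tmem_neg (tmem_divNat (n := n + 1 + 1) (by omega) (tmem_mul hS h0 D hIW hr))
  refine (show (fun ρ => w (rF ρ) (n + 2)) = _ from ?_) ▸ this
  funext ρ
  rw [w_succ_succ]
  unfold nextW
  rw [div_mul_eq_div_div, div_eq_mul_inv _ (dWc _ _ 0)]
  push_cast
  ring

/-- Soundness of `coefWTM`. [cite: BuckmasterCaolaboraGomezserrano2025, eq. (2.10)] -/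
theorem tmem_coefWTM {F G : ℝ → ℕ → ℝ} {L M : List IPoly}
    (hL0 : TMem S h (fun ρ => F ρ 0) (ent S L 0)) (hM0 : TMem S h (fun ρ => G ρ 0) (ent S M 0))
    (hM1 : TMem S h (fun ρ => G ρ 1) (ent S M 1)) :
    TMem S h (fun ρ => coefW (F ρ) (G ρ)) (coefWTM S L M) := by
  have := tmem_sub (tmem_divNat (n := 3) (by norm_num) hM1)
    (tmem_divNat (n := 3) (by norm_num) (tmem_sub hL0 hM0))
  refine (show (fun ρ => coefW (F ρ) (G ρ)) = _ from ?_) ▸ this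
  funext ρ; unfold coefW NZ_W; push_cast; ring

/-- Soundness of `slopeZTM`. [cite: BuckmasterCaolaboraGomezserrano2025, eq. (2.10)] -/
theorem tmem_slopeZTM {R : IPoly} (hR : TMem S h rF R) {F G : ℝ → ℕ → ℝ} {L M : List IPoly}
    (hL0 : TMem S h (fun ρ => F ρ 0) (ent S L 0)) (hM0 : TMem S h (fun ρ => G ρ 0) (ent S M 0))
    (hL1 : TMem S h (fun ρ => F ρ 1) (ent S L 1)) (hM1 : TMem S h (fun ρ => G ρ 1) (ent S M 1)) (m : ℕ) :
    TMem S h (fun ρ => slopeZ (rF ρ) (F ρ) (G ρ) m) (slopeZTM S R L M m) := by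
  have hd := tmem_dZcTM (S := S) (h := h) (j := 0) hL1 hM1
  have := tmem_add (tmem_add (tmem_smulInt (m : ℤ) hd) (tmem_divNat (n := 3) (by norm_num) (tmem_smulInt 2 hM1)))
    (tmem_add hR (tmem_divNat (n := 3) (by norm_num) (tmem_add hL0 (tmem_smulInt 5 hM0))))
  refine (show (fun ρ => slopeZ (rF ρ) (F ρ) (G ρ) m) = _ from ?_) ▸ this
  funext ρ; unfold slopeZ NZ_Z; push_cast; ring

/-- Soundness of `restZTM`. [cite: BuckmasterCaolaboraGomezserrano2025, eq. (2.10)] -/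
theorem tmem_restZTM (hS : 0 < S) (h0 : 0 ≤ h) {F G : ℝ → ℕ → ℝ} {L M : List IPoly} {n : ℕ}
    (hL : ∀ i, i ≤ n + 1 → TMem S h (fun ρ => F ρ i) (ent S L i))
    (hM : ∀ i, i ≤ n + 1 → TMem S h (fun ρ => G ρ i) (ent S M i)) :
    TMem S h (fun ρ => restZ (F ρ) (G ρ) n) (restZTM S h D L M n) := by
  have hsum : TMem S h (fun ρ => ∑ k ∈ range n, dZc (F ρ) (G ρ) (k + 2) * (((n - k : ℕ) : ℝ) + 1)
      * G ρ (n - k + 1)) (tsumI S (fun k => tmulI S h D (dZcTM S L M (k + 2))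
      (tsmulInt (((n - k : ℕ) : ℤ) + 1) (ent S M (n - k + 1)))) n) := by
    refine tmem_tsumI n fun k hk => ?_
    have h1 := tmem_dZcTM (S := S) (h := h) (j := k + 1) (hL (k + 2) (by omega)) (hM (k + 2) (by omega))
    have h2 := tmem_smulInt (((n - k : ℕ) : ℤ) + 1) (hM (n - k + 1) (by omega))
    have := tmem_mul hS h0 D h1 h2
    refine (show (fun ρ => dZc (F ρ) (G ρ) (k + 2) * (((n - k : ℕ) : ℝ) + 1) * G ρ (n - k + 1)) = _
      from ?_) ▸ this
    funext ρ; push_cast; ring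
  have hB := tmem_divNat (n := 3) (by norm_num) (tmem_shcauchyTM (D := D) hS h0 hL hM)
  have hC := tmem_divNat (n := 6) (by norm_num) (tmem_smulInt 5 (tmem_shcauchyTM (D := D) hS h0 hM hM))
  have hE := tmem_divNat (n := 6) (by norm_num) (tmem_shcauchyTM (D := D) hS h0 hL hL)
  have := tmem_sub (tmem_add (tmem_add hsum hB) hC) hE
  refine (show (fun ρ => restZ (F ρ) (G ρ) n) = _ from ?_) ▸ this
  funext ρ; unfold restZ; push_cast; ring

/-- **Soundness of the mirror of (2.10).** If the entries `≤ n + 2` of `L` and `≤ n + 1` of `M` enclose the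
coefficients and `IZ ∋ 1/slopeZ(n+2)`, then `nextZTM … n IZ ∋ z_{n+2}`.
[cite: BuckmasterCaolaboraGomezserrano2025, eq. (2.10)] -/
theorem tmem_nextZTM (hS : 0 < S) (h0 : 0 ≤ h) {L M : List IPoly} {n : ℕ} {IZ : IPoly}
    (hL : ∀ i, i ≤ n + 2 → TMem S h (fun ρ => w (rF ρ) i) (ent S L i))
    (hM : ∀ i, i ≤ n + 1 → TMem S h (fun ρ => z (rF ρ) i) (ent S M i))
    (hIZ : TMem S h (fun ρ => (slopeZ (rF ρ) (w (rF ρ)) (z (rF ρ)) (n + 2))⁻¹) IZ) :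
    TMem S h (fun ρ => z (rF ρ) (n + 2)) (nextZTM S h D L M n IZ) := by
  have hc := tmem_coefWTM (S := S) (h := h) (F := fun ρ i => w (rF ρ) i) (G := fun ρ i => z (rF ρ) i)
    (hL 0 (by omega)) (hM 0 (by omega)) (hM 1 (by omega))
  have hr := tmem_restZTM (D := D) (F := fun ρ i => w (rF ρ) i) (G := fun ρ i => z (rF ρ) i) hS h0
    (fun i hi => hL i (by omega)) hM
  have := tmem_neg (tmem_mul hS h0 D hIZ (tmem_add (tmem_mul hS h0 D hc (hL (n + 2) le_rfl)) hr))
  refine (show (fun ρ => z (rF ρ) (n + 2)) = _ from ?_) ▸ this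
  funext ρ
  rw [z_succ_succ]
  unfold nextZ
  ring

/-- Soundness of the data models at `P_s`: from `R ∋ r`, `Q ∋ q(r)`, `P ∋ p(r)`.
[cite: BuckmasterCaolaboraGomezserrano2025, §2.1, eqs. (2.2), (2.6)] -/
theorem tmem_PsData {R Q P : IPoly} (hR : TMem S h rF R) (hQ : TMem S h (fun ρ => q (rF ρ)) Q)
    (hP : TMem S h (fun ρ => p (rF ρ)) P) :
    TMem S h (fun ρ => w (rF ρ) 0) (W0TM S R Q) ∧ TMem S h (fun ρ => z (rF ρ) 0) (Z0TM S R Q) ∧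
      TMem S h (fun ρ => w (rF ρ) 1) (W1TM Q) ∧ TMem S h (fun ρ => z (rF ρ) 1) (Z1TM S R Q P) := by
  have h3 : TMem S h (fun _ => (3 : ℝ)) (tconst (MI.ofInt S 3)) := by
    simpa using tmem_const (S := S) (h := h) (MI.mem_ofInt S 3)
  have h2 : TMem S h (fun _ => (2 : ℝ)) (tconst (MI.ofInt S 2)) := by
    simpa using tmem_const (S := S) (h := h) (MI.mem_ofInt S 2)
  refine ⟨?_, ?_, ?_, ?_⟩
  · have := tmem_add (tmem_sub h3 (tmem_smulInt 2 hR)) (tmem_smulInt 2 hQ)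
    refine (show (fun ρ => w (rF ρ) 0) = _ from ?_) ▸ this
    funext ρ; rw [w_zero]; unfold W0; push_cast; ring
  · have := tmem_sub (tmem_sub hR h3) hQ
    refine (show (fun ρ => z (rF ρ) 0) = _ from ?_) ▸ this
    funext ρ; rw [z_zero]; unfold Z0; ring
  · have := tmem_smulInt (-3) hQ
    refine (show (fun ρ => w (rF ρ) 1) = _ from ?_) ▸ this
    funext ρ; rw [w_one]; unfold W1; push_cast; ring
  · have := tmem_divNat (n := 2) (by norm_num) (tmem_smulInt 3 (tmem_sub (tmem_add (tmem_sub h2 hR) hQ) hP))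
    refine (show (fun ρ => z (rF ρ) 1) = _ from ?_) ▸ this
    funext ρ; rw [z_one]; unfold Z1; push_cast; ring

end SonicSeries

end Monatomic

end BuckmasterCaolaboraGomezserrano2025

end Literature.Analysis.FluidPDE
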